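import Literature.NumberTheory.EllipticCurves.Kobayashi2003.SignedSelmer
import Literature.NumberTheory.EllipticCurves.Castella2018.AnticyclotomicSelmer
import Literature.NumberTheory.EllipticCurves.IwasawaDualModule
import Literature.NumberTheory.EllipticCurves.IwasawaSelmerDualProofs
import Literature.NumberTheory.EllipticCurves.IwasawaAlgebra
import Literature.NumberTheory.EllipticCurves.Rank1Residual.Predicates
import Literature.NumberTheory.EllipticCurves.HeegnerPoints
import Literature.NumberTheory.EllipticCurves.Tamagawa
import HarnessLib

/-!
# Signed (plus/minus) Selmer groups over the ANTICYCLOTOMIC tower at a supersingular prime with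
# `a_p = 0`: the `K_∞`-level signed local condition `ℋ^±_w`, Castella–Wan's nine groups
# `Sel^{𝓛_𝔭, 𝓛_𝔭̄}(K_∞, E[p^∞])` (`𝓛_v ∈ {rel, ±, str}`) with their `Λ`-duals, and the published
# structure theorems on these carriers as named facts (Iovita–Pollack 2006, B.-D. Kim 2013,
# Hatley–Lei–Vigni 2022, Longo–Vigni 2019)

Topic `Literature/NumberTheory/EllipticCurves`; namespace `Literature.NumberTheory.EllipticCurves.AcSigned`
(the object sub-namespace, as `Castella2018.AcSelmer`). Cell `pub/bsd-wall` (rung W-ALL of the BSD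
summit), literature-typer seat `bsd-wall-utd-ty1` (director-bsd g12 (142)(e)), `--supports`
stmt-BirchSwinnertonDyer-23594 = crux `TwinSplitIMCAtThreeGoodSSApZero` of the route
`UniversalToricDescent` (the twin's split anticyclotomic main conjecture at `p = 3`, good
supersingular, `a_3 = 0`). HONEST FRAMING: DEFINITIONS with bodies + PROVED unfolding/bridge lemmas +
FOUR statement-only named facts (`def … : Prop`, D-0014, hypotheses as printed and SPECIALISED as
documented; nothing is asserted, no `_holds`, no instance, no notation). Typed ≠ proved ≠ endorsed;
BSD is not advanced by this file; the crux stays open.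

## Why (the consumer), and what the tree already had

The lead prover of the crux (cell bus, utd-p2 g9, 2026-08-28 02:26Z; memos SUPSET-AT3-v8 §1,
IMAGE-OVER-K-g9 §2) reduced the `⊇`-half of the twin IMC at `p = 3`, `a_3 = 0`, to a PORT of
Castella–Wan's deduction "`±`-Heegner-point Kolyvagin system ⟹ `char_{Λac}(X^{rel,str})Λ^ur ⊇ (L_p^BDP)`"
(journal Thm. A.5 + Thm. 6.8 with (6.12)–(6.15); arXiv v2: Thm. 5.12 + §6.1), "blocked on TYPING the
`±` anticyclotomic carriers at `p = 3`". TREE FINDING recorded here: the DISCRETE signed Selmer group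
over ANY `ℤ_p`-extension `κ` of ANY number field — Kobayashi's Def. 1.1 transcribed `κ`-generally —
is already `Kobayashi2003.signedLocalPointsOfEmb` / `signedSelmerLayer` / `signedSelmerInfty W κ ε`
with the Pontryagin-dual datum `Kobayashi2003.SignedSelmerDualData W κ γ ε`; for `K` imaginary
quadratic, `p` split, `κ` anticyclotomic these ARE, verbatim, Iovita–Pollack's `Ê^±(L_n)` (§4.3) and
`Sel^±(E[p^∞]/K_n)`, `Sel^±(E[p^∞]/K_∞) = lim→` (Def. 6.7), B.-D. Kim's `E^±(k_n)` (Def. 2.1) and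
`Sel^±_p(E/F_∞)` (Def. 3.1), Hatley–Lei–Vigni's `Sel^±_{p^∞}(E/K_∞)` (Def. 3.4 at `n = ∞`; their
Remark 3.5: finite layers differ "unless the base field is `K_0 = K` or `K_∞`") and Longo–Vigni's
restricted Selmer groups — so `X_±` needs no new carrier. This file adds what was missing:

1. (Part 1) the `K_∞`-LEVEL signed local objects at a place `w ∣ v ∣ p` singled out by an embedding
   `ι : K̄ → K̄_E` (`E = K_v`): `localPointsInfty = E(K_∞·E) = ⋃_n E(K_n·E)`,
   `signedLocalPointsInfty = E^ε(K_∞·E) = ⋃_n E^ε(K_n·E)` and the Kummer condition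
   `signedKummerInfty ≤ H¹(K_∞, E[p^∞])` cut out by `ℋ^ε_w = E^ε(K_∞·E) ⊗ ℚ_p/ℤ_p` (B.-D. Kim 2013
   Def. 3.3; Hatley–Lei–Vigni (3.1)); PROVED: monotonicity, `Sel^± ⊆ Sel` locally
   (`signedKummerInfty_le_localKerOverOfEmb`), and that RESTRICTION PRESERVES KUMMER CONDITIONS
   (`map_resOfLe_localKummerOverOfEmb_le`, cocycle-level).
2. (Part 2) Castella–Wan's NINE groups `Sel^{𝓛_𝔭,𝓛_𝔭̄}(K, 𝐀^ac)` of Def. 5.1, `𝓛_v ∈ {rel, ±, str}`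
   (`PCond`), in the `K_∞`-formulation as ONE parametrised `selmer W p κ Σ 𝓛 ≤ H¹(K_∞, E[p^∞])`
   built from the blocks of `Castella2018.AcSelmer` (strict away from `p` outside `Σ`, `awayKer` /
   `infKer`; `strictDatum.strictKer` for `str`) and the signed Kummer block for `±`; PROVED:
   membership lemmas, `Σ`-monotonicity, relaxation monotonicity (`selmer_le_of_rel`), stability under
   the `Γ_K`-conjugation action (`conjH1_mem_selmer`), the BRIDGE `selmer … (PCond.at 𝔮 .str .rel) =
   Castella2018.AcSelmer.selmerAc W p κ 𝔮 Σ` (`(rel, str)` IS the tree's anticyclotomic Selmer group,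
   whose dual `AcSelmer.XAc` carries the crux's `XAc.charIdeal` and `CastellaWan2024.thm53_…`), and
   `Kobayashi2003.signedSelmerInfty W κ ε ≤ condAbove … v (.sgn ε)` at every `v ∣ p`
   (`signedSelmerInfty_le_condAbove_sgn`: the tree's `lim→ Sel^ε(E/K_n)` satisfies the `K_∞`-level
   signed condition — the containment behind HLV Def. 3.4 / Kim Def. 3.1).
3. (Part 3) the Pontryagin duals `X^{𝓛,Σ} = Hom(Sel^{𝓛,Σ}, ℚ/ℤ)` (`X`, an `abbrev`) with their
   `Λ^ac = ℤ_p⟦T⟧`-module structure `X.moduleOfGen hγ` (`T = γ − 1`; CONSTRUCTED through the tree's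
   `IwasawaDual.IsLocNil.module`, a `def` to activate with `letI` — no instance), certified by
   `X.X_smul_apply` / `X.C_smul_apply`, and the invariants the printed statements speak about as
   explicit definitions over it: `X.charIdeal`, `X.torsionCharIdeal` (`char(X_tors)`, the currency of
   `Howard2004_thmB`), `X.HasRank r`, `X.IsFGTorsion`, `X.NoFiniteSubmodule`.
4. (Part 4) the `Setting` (a `Prop` structure) and four NAMED FACTS usable AT `p = 3` (three) or
   verbatim at `p ≥ 5` (one): `bdKim2013_prop32_localPoints_noPTorsion`,
   `iovitaPollack2006_lemma21_noPTorsion_top`, `hatleyLeiVigni2022_prop39_control_base`,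
   `longoVigni2019_thm14_signedSelmerDual_rank_one`.

## Sources, VERBATIM (texts read by this seat 2026-08-28; locators)

* [CastellaWan2023] F. Castella, X. Wan, Math. Ann. 389 (2024) 2595–2636 = authors' accepted MS
  `paper:url-7157bd4f7b88` (journal p = MS p + 2594; the corpus TeX `paper:arxiv-1607.02019` is the
  SUPERSEDED arXiv v2 whose "Thm. 5.12 / §6.1" are the journal's Thm. A.5 / Thm. 6.8). §3 (MS p. 9):
  "Throughout this section, we let `E/ℚ_p` be an elliptic curve with good supersingular reduction at
  an ODD prime `p` with `a_p := p + 1 − #Ẽ(𝔽_p) = 0`"; `L_∞ = ℚ_{p,∞}·k_∞`, `G_∞ ≃ U × Γ`,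
  `Λ = ℤ_p⟦G_∞⟧`, `𝐓_𝔭 = T ⊗̂ Λ` (3.1); MS p. 13: "`Ê^+(𝔪_{m,n}) := {P ∈ Ê(𝔪_{m,n}) |
  Tr^{m,n}_{m,ℓ+1}(P) ∈ Ê(𝔪_{m,ℓ}) for all 0 ≤ ℓ < n, even ℓ}`, `Ê^−`: `−1 ≤ ℓ < n`, odd `ℓ`";
  **Def. 3.6** "Let `H¹_±(k_{m,n}, T)` be the orthogonal complement of `E^±(k_{m,n}) ⊗ ℚ_p/ℤ_p`
  under `( , )_{m,n}`"; **Prop. 3.8** "`0 → H¹_±(ℚ_p, 𝐓_𝔭) → H¹(ℚ_p, 𝐓_𝔭) —Col^±→ Λ → 0` between free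
  `Λ`-modules of rank 1, 2, and 1"; **Def. 3.12** `Log^± : H¹_±(ℚ_p, 𝐓_𝔭) → Λ`, `x = Log^±(x) b^±`.
  §4 (MS p. 17): "`K` … satisfying hypothesis (gen-H) and `p > 3` a prime of good supersingular
  reduction"; (4.1) `Cor^{n+1}_n(z[Sp^{n+1}]) = −z[Sp^{n−1}]` "since `a_p = 0`"; **Lemma 4.3**
  `H¹(K[S], 𝐓^ac)` free over `Λ^ac`; **Def. 4.5** `z_∞[S]^ε ∈ H¹(K[S], 𝐓^ac)`; (spl); **Def. 4.6**
  "Let `H¹_±(K_v, 𝐓^ac_{v₁})` be the image of `H¹_±(K_v, 𝐓_{v₁}) ≃ H¹_±(ℚ_p, 𝐓_𝔭)` under the map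
  induced by the projection `Γ ↠ Γ^ac`, and set `H¹_±(K_v, 𝐓^ac) := ⊕_i γ_i.H¹_±(K_v, 𝐓^ac_{v₁})`";
  **Lemma 4.7** `loc_v(z^±_∞) ∈ H¹_±(K_v, 𝐓^ac)`; `𝓕_±`: "`H¹_±(K_v, 𝐓^ac)` if `v ∣ p`,
  `H¹(K_v, 𝐓^ac)` if `v ∤ p`", (4.7) `Sel_±(K, 𝐓^ac)`; "`𝐀^ac := T ⊗̂ Hom_{ℤ_p}(Λ^ac, ℚ_p/ℤ_p)` … we
  let `H¹_{𝓕±}(K_v, 𝐀^ac)` be the orthogonal complement of `H¹_{𝓕±}(K_v, 𝐓^ac)` under local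
  duality … `X_± = Hom_{ℤ_p}(Sel_±(K, 𝐀^ac), ℚ_p/ℤ_p)`"; **Conj. 4.8** (`z^±_∞` not torsion; `X_±` and
  `Sel_±(K, 𝐓^ac)` of `Λ^ac`-rank one; `char(X^±_tors) = char(Sel_±(K, 𝐓^ac)/Λ^ac z^±_∞)²`) — a
  CONJECTURE (not Literature; not typed). **Def. 5.1** (MS p. 23) quoted at `PCond`/`selmer`.
  §6 (MS p. 25: `p > 3`): **Def. 6.1** `Log^±_v`; **Thm. 6.2** "`𝓛^BDP_𝔭 / Ξ_d = σ_{−1,𝔭} ·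
  Log^±_𝔭(loc_𝔭(z^±_∞))`"; **Cor. 6.4**; **Lemma 6.5** (control at height-one `P ≠ pΛ^ac`, via
  [Kim07, Prop. 4.18] at `v ∣ p`); **Lemma 6.7** "(1) `X_±` and `Sel_±(K, 𝐓^ac)` have the same
  `Λ^ac`-rank. (2) `rank X^{rel,±} = 1 + rank X^{±,str}` and `char(X^{rel,±}_tors) = char(X^{±,str}_tors)`";
  **Thm. 6.8** "(i) … `char(X^±_tors) ⊂ char(Sel_±(K, 𝐓^ac)/Λ^ac z^±_∞)²` ⟺ (ii) … `char(X^{rel,str})Λ^ur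
  ⊂ (L_p^BDP)`. The same result holds for the opposite divisibilities", proof via (6.12)
  `0 → Sel^{str,rel}(K,𝐓^ac) → Sel^{±,rel}(K,𝐓^ac) —loc_𝔭→ H¹_±(K_𝔭,𝐓^ac) → X^{rel,str} → X^{±,str} → 0`
  and (6.13); App. A (MS pp. 33–36): **Thm. A.4** (Kolyvagin system `p^d·κ^±`, `κ^±_1 = z^±_∞`),
  **Thm. A.5** "Assume that `N` is squarefree. Then `Sel_±(K, 𝐓^ac)` has `Λ^ac`-rank one, and there is
  a finitely generated `Λ^ac`-module `M` such that: (i) `X_± ∼ Λ^ac ⊕ M ⊕ M`, (ii)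
  `char_{Λac}(M) ⊃ char_{Λac}(Sel_±(K, 𝐓^ac)/Λ^ac z^±_∞)`" (self-duality of the `±` conditions from
  [Kim07, Prop. 4.11]; surjectivity of `G_ℚ` on `E[p]` from [Edi97, Prop. 2.1]).
* [IovitaPollack2006] A. Iovita, R. Pollack, J. reine angew. Math. 598 (2006), author TeX
  `paper:arxiv-math_0411496`: §2 (p. 5) "Let `E/ℚ` be an elliptic curve and `p` an odd supersingular
  prime for `E`. … Hypothesis S: The prime `p` splits completely in `K` … each `𝔭_i` is totally
  ramified in `K_∞`"; **Lemma 2.1** "Hypothesis (S) implies that `E(K_{𝔭_i})[p] = 0` and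
  `E(K_∞)[p] = 0`"; **Thm. 4.5** (any ramified `ℤ_p`-extension `L_∞/ℚ_p`, `a_p = 0`: `d_n ∈ Ê(L_n)`,
  `Tr^n_{n−1} d_n = −d_{n−2}`, `d_n, d_{n−1}` generate `Ê(L_n)`); §4.3 (p. 9) "`Ê^+(L_n) := {P ∈ Ê(L_n) |
  Tr^n_m(P) ∈ Ê(L_{m−1})` for all `1 ≤ m ≤ n`, `m` odd`}`, `Ê^−`: `m` even"; **Def. 6.7** (p. 14)
  "`Sel^±(E[p^∞]/K_n) = ker(Sel(E[p^∞]/K_n) → ∏_{𝔭∣p} E(K_{n,𝔭}) ⊗ ℚ_p/ℤ_p / Ê^±(K_{n,𝔭}) ⊗ ℚ_p/ℤ_p)`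
  and `Sel^±(E[p^∞]/K_∞) = lim→_n Sel^±(E[p^∞]/K_n)`"; **Thm. 6.8** (control); Remark 6.6 (the
  anticyclotomic case: Heegner points make the coranks unbounded, [Cornut02]).
* [BDKim2013] B. D. Kim, J. Aust. Math. Soc. 95 (2013) 189–200 (open access,
  `paper:kim2013-plus-minus-selmer-groups-supersingular-primes`): p. 189 "Let `p` be a prime number …
  `F` a number field in which `p` is unramified, and `F_∞` a `ℤ_p`-extension of `F`. We suppose that
  `F_{∞,q}` is abelian over `ℚ_p` for any prime `q` above `p`"; p. 190 "we assume that `a_p = 0`";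
  **Def. 2.1** (p. 191) "let `k_{−1}` be `k`. `E^+(k_n) = {x ∈ E(k_n) | Tr_{k_n/k_{m+1}}(x) ∈ E(k_m)`
  for every `0 ≤ m < n`, `m` even`}`, `E^−(k_n)`: `−1 ≤ m < n`, `m` odd"; p. 192 "Let
  `E^±(k_∞) = ∪E^±(k_n)`", **Prop. 2.2/2.3** `(E^−(k_∞) ⊗ ℚ_p/ℤ_p)^∨ ≅ Λ^d`, `(E^+(k_∞) ⊗ ℚ_p/ℤ_p)^∨ ≅ Λ`
  (`k = ℚ_p`); §3 (p. 192) "we assume that every prime `q` above `p` is totally ramified over `F_∞/F`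
  … `F_{∞,q}` is abelian over `ℚ_p`, and additionally, when we work with `Sel^+_p`, we assume that `p`
  splits completely over `F/ℚ` … `E` will be an elliptic curve over `ℚ` with good supersingular
  reduction at `p` and `a_p = 0`"; **Def. 3.1**, **Prop. 3.2**, **Def. 3.3**, **Prop. 3.4** (exact
  annihilators), **Def. 3.5** ("`H¹_{F±}(F_{n,w}, A_s) := 0` for `w ∤ p`"), quoted at the declarations;
  **Thm. 1.1/3.14** (no proper `Λ`-submodule of finite index when cotorsion).
* [HatleyLeiVigni2022] J. Hatley, A. Lei, S. Vigni, Manuscripta Math. 167 (2022) 589–612, author TeX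
  `paper:arxiv-2003.10301`: §1.1 "`p` will denote an odd prime number. Let `E/ℚ` be an elliptic curve
  of conductor `N` with good supersingular reduction at `p` and `a_p(E) = 0` … `K` an imaginary
  quadratic field such that all the primes dividing `pN` split in `K` … We assume that the two primes
  of `K` above `p` are totally ramified in `K_∞`; this … holds if `p` does not divide the class number
  of `K`"; (Heeg), (Tam) "the prime `p` does not divide `#(E/E⁰)`"; (3.1) "`ℋ^±_v := ⋃_{n≥0}
  Ê^±(K_{n,v}) ⊗ ℚ_p/ℤ_p`", `ℋ^±_{n,v} := (ℋ^±_v)^{Gal(K_{∞,v}/K_{n,v})}`; **Prop. 3.2** ((a)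
  `(ℋ^±_v)^∨` free of rank one over `Λ` [Kim]; (b) exact annihilator); **Def. 3.4**; **Remark 3.5**;
  **Lemma 3.7** "`Sel^±_{p^m}(E/K) = Sel_{p^m}(E/K)`"; **Prop. 3.9** (quoted at the fact); §4
  (`E^±(K_n)`, `z^±_n`, Prop. 4.4/4.5 [LV]: `𝓗^±_∞` free of rank one); **Thm. 1.1** (under (Heeg) and
  (mod `p`): no proper `Λ`-submodule of finite index; "in our setting the plus/minus Selmer groups have
  `Λ`-corank one").
* [LongoVigni2019] M. Longo, S. Vigni, Boll. UMI 12 (2019), author TeX `paper:arxiv-1503.07812` p. 3: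
  Assumptions 1.1–1.3 and **Thm. 1.4** (quoted at the fact).

## READING FLAGS (informational — where the transcription is a reading, not a printed sentence)

* `CW24-local-condition`: Castella–Wan DEFINE the signed condition above `p` over the anticyclotomic
  tower (Def. 4.6) as the `Γ ↠ Γ^ac`-image of the TWO-VARIABLE signed submodule `H¹_±(ℚ_p, 𝐓_𝔭) =
  lim← ker P^±_{m,n}` of §3 (trace conditions in the CYCLOTOMIC direction over unramified bases
  `k_{m,n}`), and `H¹_{𝓕±}(K_v, 𝐀^ac)` as its orthogonal complement; this file's `condAbove … (.sgn ε)`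
  is B.-D. Kim's / Iovita–Pollack's / Hatley–Lei–Vigni's `ℋ^±_w` (trace conditions along the
  anticyclotomic local tower itself). Castella–Wan use the latter presentation too (§6.1, MS p. 25:
  "`a^± = {a^±_m} ∈ lim←_m H¹_±(K^ac_{m,v₁}, T) ≃ H¹_±(K_v, 𝐓^ac_{v₁})`"; Lemma 6.5 and Thm. A.5 invoke
  [Kim07, Props. 4.11, 4.18] for the `v ∣ p` conditions), but the IDENTITY of the two recipes is not a
  displayed statement of [CastellaWan2023]; a consumer porting Thm. 6.8 / A.5 onto `selmer` carries it.
* `away-p`: at places `w ∤ p` of `K_∞` this file (like `Castella2018.AcSelmer`) imposes the STRICT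
  condition (`res_w = 0`), which is Castella–Wan's `H¹_{𝓕±}(K_v, 𝐀^ac)` for `v ∤ p` (orthogonal
  complement of all of `H¹(K_v, 𝐓^ac)`, §4.2) and B.-D. Kim's Def. 3.5; B.-D. Kim's Def. 3.1,
  Iovita–Pollack Def. 6.7, Hatley–Lei–Vigni Def. 3.4 and the tree's `Kobayashi2003.signedSelmerInfty`
  use instead the Kummer (`E(K_{n,w}) ⊗ ℚ_p/ℤ_p = 0`-image) / unramified-outside-`Σ` conditions — the
  same groups up to the standard finite-level identifications (cf. the tree flag `BCS-2VAR-away-p`);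
  `signedSelmerInfty_le_condAbove_sgn` records the part of the comparison that is an inclusion of
  definitions (above `p`).
* `Shapiro`: `H¹(K, 𝐀^ac) = H¹(K_∞, E[p^∞])` with local conditions place by place above `v` (all
  `Γ_K`-conjugates of the chosen place) is the `K_∞`-formulation of the tree (`GreenbergSelmer`,
  `Castella2018.AcSelmer`), a docstring pointer, not a formalised step.
* `tot-ram-via-h_K`: the facts carry "`p ∤ h_K`" (`Setting.not_dvd_classNumber`), the printed
  sufficient condition, in place of "the primes above `p` are totally ramified in `K_∞/K`"
  (TODO(general form): `ZpExtension.TotallyRamifiedFrom κ 0`).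
* `HLV-layers`: Hatley–Lei–Vigni's finite-layer groups use Kim's `ℋ^±_{n,v}`, not Kobayashi's
  `E^±(K_{n,v}) ⊗ ℚ_p/ℤ_p`; only the layers `n = 0` (`= Sel_{p^∞}(E/K)`, Lemma 3.7) and `n = ∞` are
  transcribed (`hatleyLeiVigni2022_prop39_control_base`).
* `LV-D=1`: Longo–Vigni's Thm. 1.4 is transcribed for `D = 1` (classical Heegner hypothesis);
  TODO(general form): `N = MD`, `D` the square-free product of an even number of inert primes.
* Signs/indices: `ε = 1` is "plus/even", `ε = −1` "minus/odd" in Kobayashi's labelling (the tree's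
  `Int.negOnePow m = ε`, `0 ≤ m < n`); Iovita–Pollack's `1 ≤ m ≤ n` indexes `m − 1`; B.-D. Kim's and
  Castella–Wan's extra index `m = −1` for `E^−` (`k_{−1} := k`) is a vacuous condition.

## NOT in this file (and why)

* The COMPACT side: `Sel_±(K, 𝐓^ac)` / `Sel^{𝓛}(K, 𝐓^ac)` ((4.7), Def. 5.1 for `M = 𝐓^ac`), the
  signed Heegner classes `z_∞[S]^ε`, `z^±_∞` (Def. 4.5), `H¹_±(K_v, 𝐓^ac)` and `Log^±_v` (Def. 4.6,
  6.1), `Ξ_d`: their honest carriers need `lim←_n H¹(K_n, T)` with signed conditions = exact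
  annihilators of `ℋ^±_{n,v}[p^k]` under the local Tate pairing (B.-D. Kim Def. 3.5) — the tree types
  `lim←` objects as hypothesis structures pinned to finite levels (`WeierstrassCurve.LambdaAdicSelmerData`,
  `HeegnerFamily`, `heegnerModule`), and the signed analogue is a separate section file
  (TODO(compact signed carriers): `SignedLambdaAdicSelmerData`, `SignedHeegnerClassData` on
  `HeegnerFamily` with (4.1), Hatley–Lei–Vigni Def. 4.3 `z^±_n ∈ E^±(K_n)`).
* Castella–Wan Thm. 6.2, Cor. 6.4, Lemma 6.5, Lemma 6.7, Thm. 6.8, Thm. 6.9, Thm. 6.10, Thm. A.4,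
  Thm. A.5: printed for `p > 3` AND on the compact carriers above — recorded here (locators) as the
  ARCHITECTURE of the `p = 3` port, not typed; Conj. 4.8 / 5.2 are conjectures (Summits-side
  `@[conjecture]` if ever needed, never Literature facts).
* B.-D. Kim 2013 Prop. 2.2/2.3 and Hatley–Lei–Vigni Prop. 3.2 (a) (`(ℋ^±_w)^∨ ≅ Λ`), Prop. 3.4 /
  Prop. 3.2 (b) (exact annihilators): need a `Λ`-structure on the dual of the LOCAL group
  `signedLocalPointsInfty ⊗ ℚ_p/ℤ_p` and the local Tate pairing on the tree's `H¹`'s (TODO).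
  B.-D. Kim Thm. 1.1/3.14 and Cor. 3.15 (cotorsion case; in the Heegner setting `Sel^±` has corank one,
  so not on the crux's path), Iovita–Pollack Thm. 4.5/6.8, Hatley–Lei–Vigni Thm. 1.1 (hypothesis
  (mod `p`) is phrased with the `±` Heegner points): typable later on the same carriers.
* A. Matar, Res. Number Theory 7 (2021) no. 3 (plus/minus Selmer groups and anticyclotomic
  `ℤ_p`-extensions): text unobtainable this session (acquisition requests acq-13695, acq-13696);
  B.-D. Kim, Canad. J. Math. 66 (2014) (two-variable signed Selmer groups; not held); Kitajima–Otsuki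
  2018 is cyclotomic (tree: `KitajimaOtsuki2018/*`).

## The `p = 3` port this serves (Castella–Wan's route, for the next lead on the crux; locators)

§3 is printed for ODD `p` (Prop. 3.8, Lemma 3.9 [DI08, Lem. 3.9], Prop. 3.11, Def. 3.12, Prop. 3.14 are
citable at `p = 3`); §4–§6 and App. A display `p > 3`, used in print at: Prop. 4.1 (`E[p]`
irreducible [Edi92] to choose `q`), Lemma 4.3/6.6 (`E[p]` absolutely irreducible over `G_K`),
Lemma 6.5 ([Kim07, Prop. 4.18]), Thm. A.5 ([Kim07, Prop. 4.11] self-duality; [Edi97] big image;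
[How04b, Thm. 2.2.2]), Thm. 6.2 ([CH18] / [BCK21, Thm. 4.4]); the image input "`G_K ↠ Aut_{ℤ_p}(T)`"
of [How04a/b] at `p = 3` is the tree's `…Theorems.ThreeAdicImageOverK` (utd-p2 g9), `E(K_∞)[3] = 0`
is `iovitaPollack2006_lemma21_noPTorsion_top` here (odd `p`), the control at the augmentation ideal
is `hatleyLeiVigni2022_prop39_control_base` (odd `p`), and the BDP frame is the tree's
`IsBDPLFunction` / `CastellaWan2024.IsCWBDPLFunction`.
-/

noncomputable section

open scoped Classical

open NumberField IsDedekindDomain Field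
open Literature.NumberTheory.EllipticCurves Literature.NumberTheory.GaloisRepresentations
open Literature.NumberTheory.EllipticCurves.GreenbergSelmer
open Literature.NumberTheory.EllipticCurves.Kobayashi2003

universe u

namespace Literature.NumberTheory.EllipticCurves.AcSigned

/-! ## Part 1. The signed local points and the signed Kummer condition over `K_∞` -/

section Local

variable {K : Type u} [Field K] {p : ℕ} [Fact p.Prime] (κ : ZpExtension K p)
variable {E : Type u} [Field E] [Algebra K E] (ι : AlgebraicClosure K →ₐ[K] AlgebraicClosure E)
variable (W : WeierstrassCurve K)

/-- **`E(K_∞·E) = ⋃_n E(K_n·E)`** — the points of `W` over the local tower at the place singled out by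
`ι` (the union, i.e. `⨆`, of the tree's layer groups `Kobayashi2003.localLayerPointsOfEmb κ ι W n`;
the family is monotone, `Kobayashi2003.localLayerPointsOfEmb_mono`). For `K` imaginary quadratic,
`κ` anticyclotomic, `E = K_v` with `v ∣ p` split this is `E(K_{∞,w})`, `w ∣ v` (Iovita–Pollack:
"`L_v` is a union of completions of finite extensions", §2.1; B.-D. Kim 2013, §2: `k_∞ = ⋃ k_n`).
[cite: IovitaPollack2006, §2.1 (arXiv:math/0411496 p. 5)] -/
def localPointsInfty : AddSubgroup (localPoints W E) :=
  ⨆ n : ℕ, localLayerPointsOfEmb κ ι W n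

/-- Each layer `E(K_n·E)` lies in `E(K_∞·E)`. [cite: IovitaPollack2006, §2.1 (arXiv:math/0411496 p. 5)] -/
theorem localLayerPointsOfEmb_le_localPointsInfty (n : ℕ) :
    localLayerPointsOfEmb κ ι W n ≤ localPointsInfty κ ι W :=
  le_iSup (fun n ↦ localLayerPointsOfEmb κ ι W n) n

/-- **`E^ε(K_∞·E) = ⋃_n E^ε(K_n·E)`** (`ε = 1`: plus, `ε = -1`: minus) — the union (`⨆`) of
Kobayashi's signed subgroups `Kobayashi2003.signedLocalPointsOfEmb κ ι W ε n` (trace conditions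
`Tr_{n/m+1} P ∈ E(K_m·E)` for `m < n`, `(-1)^m = ε`) over the layers of the local tower at the place
singled out by `ι`. B.-D. Kim, J. Aust. Math. Soc. 95 (2013), §2 after Def. 2.1: "Let
`E^±(k_∞) = ∪ E^±(k_n)`" (for `k_∞/k` a totally ramified `ℤ_p`-extension of an unramified `k/ℚ_p`,
abelian over `ℚ_p`); Hatley–Lei–Vigni (3.1): `ℋ^±_v := ⋃_{n ≥ 0} Ê^±(K_{n,v}) ⊗ ℚ_p/ℤ_p` (formal-group
points; same group after `⊗ ℤ_p`, the reduction having order prime to `p` at a supersingular `v`);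
Iovita–Pollack §4.3 (`Ê^±(L_n)` for ANY ramified `ℤ_p`-extension `L_∞/ℚ_p`).
[cite: BDKim2013, §2 Def. 2.1 and the line after it (p. 192)] -/
def signedLocalPointsInfty (ε : ℤˣ) : AddSubgroup (localPoints W E) :=
  ⨆ n : ℕ, signedLocalPointsOfEmb κ ι W ε n

/-- Each `E^ε(K_n·E)` lies in `E^ε(K_∞·E)`. [cite: BDKim2013, §2 Def. 2.1 (p. 191–192)] -/
theorem signedLocalPointsOfEmb_le_signedLocalPointsInfty (ε : ℤˣ) (n : ℕ) :
    signedLocalPointsOfEmb κ ι W ε n ≤ signedLocalPointsInfty κ ι W ε :=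
  le_iSup (fun n ↦ signedLocalPointsOfEmb κ ι W ε n) n

/-- `E^ε(K_∞·E) ≤ E(K_∞·E)`. [cite: BDKim2013, §2 Def. 2.1 (p. 191–192)] -/
theorem signedLocalPointsInfty_le_localPointsInfty (ε : ℤˣ) :
    signedLocalPointsInfty κ ι W ε ≤ localPointsInfty κ ι W :=
  iSup_mono fun n ↦ signedLocalPointsOfEmb_le κ ι W ε n

/-- The base points `E(E) = E(K_0·E)` lie in `E^ε(K_∞·E)` for both signs (no trace condition at the
bottom layer; Kobayashi2003's `localLayerPointsOfEmb_zero_le_signedLocalPointsOfEmb`). Hatley–Lei–Vigni,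
proof of Lemma 3.7: "`E(K_v)/p^m E(K_v)` is contained in `ℋ^±_{0,v}[p^m]`".
[cite: HatleyLeiVigni2022, Lemma 3.7 (proof)] -/
theorem localLayerPointsOfEmb_zero_le_signedLocalPointsInfty (ε : ℤˣ) :
    localLayerPointsOfEmb κ ι W 0 ≤ signedLocalPointsInfty κ ι W ε :=
  (localLayerPointsOfEmb_zero_le_signedLocalPointsOfEmb κ ι W ε 0).trans
    (signedLocalPointsOfEmb_le_signedLocalPointsInfty κ ι W ε 0)

end Local

section Kummer

variable {K : Type u} [Field K] (W : WeierstrassCurve K) (p : ℕ) [Fact p.Prime]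
  (κ : ZpExtension K p)
variable {E : Type u} [Field E] [Algebra K E] (ι : AlgebraicClosure K →ₐ[K] AlgebraicClosure E)

/-- **The signed local condition over `K_∞` at the place `w` singled out by `ι`**, pulled back to
`H¹(K_∞, E[p^∞])`: the classes whose restriction to `Gal(K̄_E/K_∞·E)` is the Kummer class of an
element of `ℋ^ε_w := E^ε(K_∞·E) ⊗ ℚ_p/ℤ_p` (Kobayashi2003's `localKummerOverOfEmb` for `H = ker κ`
and `A = E^ε(K_∞·E)`). B.-D. Kim 2013, Def. 3.3: "For any prime `w` of `F_∞` above `p`, we define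
`H^±_w = E^±(F_{∞,w}) ⊗ ℚ_p/ℤ_p ⊂ H¹(F_{∞,w}, A)`"; Def. 3.1: `Sel^±_p(E/F_∞)` is cut out at `v ∣ p`
by `H¹(F_{∞,v}, A)/E^±(F_{∞,v}) ⊗ ℚ_p/ℤ_p`. Hatley–Lei–Vigni (3.1) and Remark 3.1 (the same group,
viewed in `H¹(K_{∞,v}, A)` by the Kummer map); Iovita–Pollack §4.3/Def. 6.7. READING (flag
`CW24-local-condition`, module docstring): for `K` imaginary quadratic, `κ` anticyclotomic and
`p = 𝔭𝔭̄` split this is read as Castella–Wan's `H¹_{𝓕_±}(K_v, 𝐀^ac)` of Def. 4.6/(4.6)/(4.7), which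
the source defines through the two-variable signed Coleman maps and the projection `Γ ↠ Γ^ac`.
[cite: BDKim2013, Def. 3.3 and Def. 3.1 (p. 193)] -/
def signedKummerInfty (ε : ℤˣ) : AddSubgroup (W.subgroupH1 p κ.kerSubgroup) :=
  localKummerOverOfEmb W p κ.kerSubgroup ι (signedLocalPointsInfty κ ι W ε)

/-- The layer-`n` signed Kummer condition (cut out by `E^ε(K_n·E)`) implies the `K_∞`-level one (cut
out by the union), by monotonicity of the Kummer condition in `A`
(`Kobayashi2003.localKummerOverOfEmb_mono`). [cite: BDKim2013, Def. 3.3 (p. 193)] -/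
theorem localKummerOverOfEmb_signedLocalPointsOfEmb_le (ε : ℤˣ) (n : ℕ) :
    localKummerOverOfEmb W p κ.kerSubgroup ι (signedLocalPointsOfEmb κ ι W ε n) ≤
      signedKummerInfty W p κ ι ε :=
  localKummerOverOfEmb_mono (signedLocalPointsOfEmb_le_signedLocalPointsInfty κ ι W ε n)

/-- The signed condition refines the classical local condition "dies in `H¹(K_∞·E, E)`"
(`WeierstrassCurve.localKerOverOfEmb`; Kobayashi2003's `localKummerOverOfEmb_le_localKerOverOfEmb`):
`Sel^± ⊆ Sel`. B.-D. Kim 2013, Def. 3.1 vs the `p^∞`-Selmer group recalled on p. 189.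
[cite: BDKim2013, Def. 3.1 (p. 193)] -/
theorem signedKummerInfty_le_localKerOverOfEmb (ε : ℤˣ) :
    signedKummerInfty W p κ ι ε ≤ W.localKerOverOfEmb p κ.kerSubgroup ι :=
  localKummerOverOfEmb_le_localKerOverOfEmb _

omit [Fact p.Prime] in
/-- **Restriction preserves the Kummer condition**: for `H ≤ H'` (fields `L' ⊆ L`), the restriction
`H¹(H', E[p^∞]) → H¹(H, E[p^∞])` carries the Kummer condition cut out by `A` at the place of `L'`
singled out by `ι` into the one at the place of `L` singled out by `ι` (the restriction of the Kummer
cocycle `τ ↦ τQ − Q` is the Kummer cocycle of the same `Q` on the smaller group; functoriality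
`map_oneCocycleClass`). Used with `H = ker κ ≤ H' = Gal(K̄/K_n)`: the maps
`Sel^±(E/K_n) → Sel^±(E/K_∞)` of B.-D. Kim 2013 Def. 3.1 / Iovita–Pollack Def. 6.7 respect the signed
conditions. [cite: BDKim2013, Def. 3.1 (p. 193), the direct limit `Sel^±_p(E/F_∞)`] -/
theorem map_resOfLe_localKummerOverOfEmb_le {H H' : Subgroup (Field.absoluteGaloisGroup K)}
    (h : H ≤ H') (A : AddSubgroup (localPoints W E)) :
    (localKummerOverOfEmb W p H' ι A).map (W.resOfLe p h) ≤ localKummerOverOfEmb W p H ι A := by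
  rintro _ ⟨c, ⟨φ, Q, k, rfl, hA, hτ⟩, rfl⟩
  refine ⟨contOneCocycles.pullback (subgroupInclusion h)
      (resHomOfEquivariant (subgroupInclusion h) (AddMonoidHom.id (W.geomPrimaryTorsion p))
        fun _ _ ↦ rfl) φ, Q, k, ?_, hA, fun τ ↦ hτ ⟨(τ : Field.absoluteGaloisGroup E), h τ.2⟩⟩
  change _ = (ContinuousCohomology.map (subgroupInclusion h) (resHomOfEquivariant _ _ _) 1).hom
    (oneCocycleClass (discreteTopRep H' (W.geomPrimaryTorsion p)) φ)
  rw [map_oneCocycleClass]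

end Kummer

/-! ## Part 2. Castella–Wan's nine Selmer groups `Sel^{𝓛_𝔭, 𝓛_𝔭̄}(K_∞, E[p^∞])` (Def. 5.1) in the
`K_∞`-formulation -/

section PCond

variable {K : Type u} [Field K]

/-- **The type of a local condition at a prime above `p`** in Castella–Wan's Def. 5.1: "For
`v ∈ {𝔭, 𝔭̄}` and `𝓛_v ∈ {rel, ±, str}`, set `H¹_{𝓛_v}(K_v, M) = H¹(K_v, M)` if `𝓛_v = rel`,
`H¹_±(K_v, M) = H¹_{𝓕_±}(K_v, M)` if `𝓛_v = ±`, `0` if `𝓛_v = str`" — relaxed, signed (`sgn 1` =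
plus, `sgn (-1)` = minus) or strict. [cite: CastellaWan2023, Def. 5.1 (journal p. 2617 = MS p. 23)] -/
inductive PCond : Type
  /-- `rel`: no condition. -/
  | rel : PCond
  /-- `sgn ε`: the signed (Kummer) condition `ℋ^ε`. -/
  | sgn : ℤˣ → PCond
  /-- `str`: the strict condition `0`. -/
  | str : PCond

/-- "`a` at `𝔮`, `b` at every other prime (above `p`)": the assignments of Def. 5.1 for the pair
`{𝔭, 𝔭̄}` (`p = 𝔭𝔭̄` split), e.g. `PCond.at 𝔭̄ .str .rel` = `(rel, str)`, `PCond.at 𝔭̄ .str (.sgn ε)`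
= `(±, str)`, `PCond.at 𝔭 .rel (.sgn ε)` = `(rel, ±)`, `fun _ ↦ .sgn ε` = `(±, ±)`.
[cite: CastellaWan2023, Def. 5.1 (journal p. 2617 = MS p. 23)] -/
def PCond.at (𝔮 : HeightOneSpectrum (𝓞 K)) (a b : PCond) : HeightOneSpectrum (𝓞 K) → PCond :=
  fun v ↦ if v = 𝔮 then a else b

/-- Unfolding `PCond.at` at `𝔮`. [cite: CastellaWan2023, Def. 5.1 (journal p. 2617 = MS p. 23)] -/
@[simp] theorem PCond.at_self (𝔮 : HeightOneSpectrum (𝓞 K)) (a b : PCond) :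
    PCond.at 𝔮 a b 𝔮 = a := by
  simp [PCond.at]

/-- Unfolding `PCond.at` off `𝔮`. [cite: CastellaWan2023, Def. 5.1 (journal p. 2617 = MS p. 23)] -/
theorem PCond.at_of_ne {𝔮 v : HeightOneSpectrum (𝓞 K)} (a b : PCond) (h : v ≠ 𝔮) :
    PCond.at 𝔮 a b v = b := by
  simp [PCond.at, h]

end PCond

section Global

variable {K : Type u} [Field K] [NumberField K]
variable (W : WeierstrassCurve K) (p : ℕ) [Fact p.Prime] (κ : ZpExtension K p)

/-- **The local condition above a prime `v ∣ p` over `K_∞`** as a subgroup of `H¹(K_∞, E[p^∞])`,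
imposed at EVERY place of `K_∞` above `v` (all conjugates `conj_σ`, `σ ∈ Γ_K`, of the condition at
the chosen place, as in `GreenbergSelmer.selmerGroupOver` / `Castella2018.AcSelmer.selmerOver`):
`rel` ↦ no condition; `str` ↦ the strict kernel for the datum `M⁺_v = 0` (the class dies in
`H¹(K_{∞,w}, E[p^∞])`; `Castella2018.AcSelmer.strictDatum`); `sgn ε` ↦ the signed Kummer condition
`ℋ^ε_w` (`signedKummerInfty` at the embedding `closureEmb` of the completion `K_v`). Castella–Wan
Def. 5.1 with §4.2 ("`H¹_{𝓕_±}(K_v, 𝐀^ac)` … the orthogonal complement") in the `K_∞`-formulation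
(Shapiro's lemma, as in `Castella2018.AcSelmer`); B.-D. Kim 2013 Def. 3.1/3.5.
[cite: CastellaWan2023, Def. 5.1 (journal p. 2617 = MS p. 23)] [cite: BDKim2013, Def. 3.1, Def. 3.5 (pp. 193–194)] -/
def condAbove (v : HeightOneSpectrum (𝓞 K)) : PCond → AddSubgroup (W.subgroupH1 p κ.kerSubgroup)
  | .rel => ⊤
  | .sgn ε => ⨅ σ : absoluteGaloisGroup K,
      (signedKummerInfty W p κ (closureEmb (K := K) (v.adicCompletion K)) ε).comap
        (conjH1 κ.kerSubgroup (W.geomPrimaryTorsion p) σ)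
  | .str => ⨅ σ : absoluteGaloisGroup K,
      ((Castella2018.AcSelmer.strictDatum (W.geomPrimaryTorsion p) v).strictKer κ.kerSubgroup).comap
        (conjH1 κ.kerSubgroup (W.geomPrimaryTorsion p) σ)

/-- Membership in the relaxed condition: none.
[cite: CastellaWan2023, Def. 5.1 (journal p. 2617 = MS p. 23)] -/
@[simp] theorem mem_condAbove_rel (v : HeightOneSpectrum (𝓞 K)) (c : W.subgroupH1 p κ.kerSubgroup) :
    c ∈ condAbove W p κ v .rel := AddSubgroup.mem_top c

/-- Membership in the signed condition: every conjugate satisfies the signed Kummer condition at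
the chosen place above `v`. [cite: CastellaWan2023, Def. 5.1 and §4.2 (4.6)–(4.7) (MS pp. 21–23)] -/
theorem mem_condAbove_sgn_iff (v : HeightOneSpectrum (𝓞 K)) (ε : ℤˣ)
    (c : W.subgroupH1 p κ.kerSubgroup) :
    c ∈ condAbove W p κ v (.sgn ε) ↔ ∀ σ : absoluteGaloisGroup K,
      conjH1 κ.kerSubgroup (W.geomPrimaryTorsion p) σ c ∈
        signedKummerInfty W p κ (closureEmb (K := K) (v.adicCompletion K)) ε := by
  simp only [condAbove, AddSubgroup.mem_iInf, AddSubgroup.mem_comap]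

/-- Membership in the strict condition: every conjugate dies at the chosen place above `v`.
[cite: CastellaWan2023, Def. 5.1 (journal p. 2617 = MS p. 23)] -/
theorem mem_condAbove_str_iff (v : HeightOneSpectrum (𝓞 K)) (c : W.subgroupH1 p κ.kerSubgroup) :
    c ∈ condAbove W p κ v .str ↔ ∀ σ : absoluteGaloisGroup K,
      conjH1 κ.kerSubgroup (W.geomPrimaryTorsion p) σ c ∈
        (Castella2018.AcSelmer.strictDatum (W.geomPrimaryTorsion p) v).strictKer κ.kerSubgroup := by
  simp only [condAbove, AddSubgroup.mem_iInf, AddSubgroup.mem_comap]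

/-- Each `condAbove` is stable under the conjugation action of `Γ_K` (the family of conjugates is
permuted, `conjH1_mul_holds`). [cite: CastellaWan2023, §4.2 (the `Λ^ac`-module structure, MS p. 22)] -/
theorem conjH1_mem_condAbove (v : HeightOneSpectrum (𝓞 K)) (L : PCond) (γ : absoluteGaloisGroup K)
    {c : W.subgroupH1 p κ.kerSubgroup} (hc : c ∈ condAbove W p κ v L) :
    conjH1 κ.kerSubgroup (W.geomPrimaryTorsion p) γ c ∈ condAbove W p κ v L := by
  have e : ∀ σ : absoluteGaloisGroup K,
      conjH1 κ.kerSubgroup (W.geomPrimaryTorsion p) σ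
          (conjH1 κ.kerSubgroup (W.geomPrimaryTorsion p) γ c) =
        conjH1 κ.kerSubgroup (W.geomPrimaryTorsion p) (σ * γ) c :=
    fun σ ↦ by rw [conjH1_mul_holds κ.kerSubgroup (W.geomPrimaryTorsion p) σ γ]; rfl
  cases L with
  | rel => exact AddSubgroup.mem_top _
  | sgn ε =>
    rw [mem_condAbove_sgn_iff] at hc ⊢
    exact fun σ ↦ by rw [e]; exact hc (σ * γ)
  | str =>
    rw [mem_condAbove_str_iff] at hc ⊢
    exact fun σ ↦ by rw [e]; exact hc (σ * γ)

/-- **The conditions away from `p`** of all nine groups (and of `Castella2018.AcSelmer.selmerOver`,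
verbatim its first component): trivial at every place of `K_∞` above a finite `v ∤ p` with `v ∉ Σ`
(`awayKer`) and above every infinite place (`infKer`) — Castella–Wan §4.2: at `v ∤ p`,
`H¹_{𝓕_±}(K_v, 𝐀^ac)` is the orthogonal complement of `H¹_{𝓕_±}(K_v, 𝐓^ac) = H¹(K_v, 𝐓^ac)`, i.e.
`0`; Def. 5.1 (`X^{𝓛,Σ}`: "relaxing the local conditions at the primes `w ∈ Σ`"); B.-D. Kim 2013
Def. 3.5: "`H¹_{F±}(F_{n,w}, A_s) := 0` for `w ∤ p`".
[cite: CastellaWan2023, §4.2 and Def. 5.1 (MS pp. 22–23)] [cite: BDKim2013, Def. 3.5 (p. 194)] -/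
def awayConditions (S : Set (HeightOneSpectrum (𝓞 K))) : AddSubgroup (W.subgroupH1 p κ.kerSubgroup) :=
  (⨅ (v : HeightOneSpectrum (𝓞 K)) (_ : ((p : ℕ) : 𝓞 K) ∉ v.asIdeal) (_ : v ∉ S)
      (σ : absoluteGaloisGroup K),
      (awayKer κ.kerSubgroup (W.geomPrimaryTorsion p) v).comap
        (conjH1 κ.kerSubgroup (W.geomPrimaryTorsion p) σ)) ⊓
    ⨅ (w : InfinitePlace K) (σ : absoluteGaloisGroup K),
      (infKer κ.kerSubgroup (W.geomPrimaryTorsion p) w).comap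
        (conjH1 κ.kerSubgroup (W.geomPrimaryTorsion p) σ)

/-- Membership in `awayConditions`. [cite: CastellaWan2023, §4.2 and Def. 5.1 (MS pp. 22–23)] -/
theorem mem_awayConditions_iff {S : Set (HeightOneSpectrum (𝓞 K))} (c : W.subgroupH1 p κ.kerSubgroup) :
    c ∈ awayConditions W p κ S ↔
      (∀ (v : HeightOneSpectrum (𝓞 K)), ((p : ℕ) : 𝓞 K) ∉ v.asIdeal → v ∉ S →
          ∀ σ : absoluteGaloisGroup K, conjH1 κ.kerSubgroup (W.geomPrimaryTorsion p) σ c ∈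
            awayKer κ.kerSubgroup (W.geomPrimaryTorsion p) v) ∧
        ∀ (w : InfinitePlace K) (σ : absoluteGaloisGroup K),
          conjH1 κ.kerSubgroup (W.geomPrimaryTorsion p) σ c ∈
            infKer κ.kerSubgroup (W.geomPrimaryTorsion p) w := by
  simp only [awayConditions, AddSubgroup.mem_inf, AddSubgroup.mem_iInf, AddSubgroup.mem_comap]

/-- **`Sel^{𝓛,Σ}(K_∞, E[p^∞]) ⊆ H¹(K_∞, E[p^∞])`** for an assignment `𝓛` of local condition types to
the primes above `p` (values at primes not above `p` are ignored) and a set `Σ` of finite places away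
from `p` at which the condition is relaxed: `awayConditions` away from `p`, and `condAbove v (𝓛 v)`
at every `v ∣ p`. This is Castella–Wan's `Sel^𝓛(K, 𝐀^ac)`, `𝓛 = {𝓛_𝔭, 𝓛_𝔭̄}`, Def. 5.1 — "`Sel^{rel,str}(K, 𝐀^ac)`
consists of classes which are trivial at `𝔭̄` and satisfy no condition at `𝔭`, and
`Sel^{±,±}(K, 𝐀^ac)` recovers the Selmer module `Sel_±(K, 𝐀^ac)` of §4.2" — in the
`K_∞`-formulation (`H¹(K, 𝐀^ac) = H¹(K_∞, E[p^∞])` by Shapiro's lemma, the step the tree leaves as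
a docstring pointer, exactly as for `Castella2018.AcSelmer.selmerAc`), with the signed condition at
`v ∣ p` transcribed as B.-D. Kim's `ℋ^±_w` (flag `CW24-local-condition`). For `𝓛 ≡ ±`: B.-D. Kim
2013 Def. 3.1/3.5, Hatley–Lei–Vigni Def. 3.4 (`n = ∞`), Iovita–Pollack Def. 6.7 over `K_∞` — the
signed Selmer group `Sel^±(E/K_∞)`, up to the away-from-`p` flag `away-p` of the module docstring;
the tree's `Kobayashi2003.signedSelmerInfty (W) κ ε` is the same group presented as
`lim→_n Sel^±(E/K_n)`. [cite: CastellaWan2023, Def. 5.1 (journal p. 2617 = MS p. 23)]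
[cite: BDKim2013, Def. 3.1, Def. 3.3, Def. 3.5 (pp. 193–194)] -/
def selmer (S : Set (HeightOneSpectrum (𝓞 K))) (L : HeightOneSpectrum (𝓞 K) → PCond) :
    AddSubgroup (W.subgroupH1 p κ.kerSubgroup) :=
  awayConditions W p κ S ⊓
    ⨅ (v : HeightOneSpectrum (𝓞 K)) (_ : ((p : ℕ) : 𝓞 K) ∈ v.asIdeal), condAbove W p κ v (L v)

variable {W p κ}

/-- Membership in `Sel^{𝓛,Σ}(K_∞, E[p^∞])`. [cite: CastellaWan2023, Def. 5.1 (journal p. 2617 = MS p. 23)] -/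
theorem mem_selmer_iff {S : Set (HeightOneSpectrum (𝓞 K))} {L : HeightOneSpectrum (𝓞 K) → PCond}
    (c : W.subgroupH1 p κ.kerSubgroup) :
    c ∈ selmer W p κ S L ↔ c ∈ awayConditions W p κ S ∧
      ∀ (v : HeightOneSpectrum (𝓞 K)), ((p : ℕ) : 𝓞 K) ∈ v.asIdeal → c ∈ condAbove W p κ v (L v) := by
  simp only [selmer, AddSubgroup.mem_inf, AddSubgroup.mem_iInf]

/-- `Σ ⊆ Σ'` ⟹ `Sel^{𝓛,Σ} ≤ Sel^{𝓛,Σ'}` ("relaxing the local conditions at the primes `w ∈ Σ`").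
[cite: CastellaWan2023, Def. 5.1 (journal p. 2617 = MS p. 23)] -/
theorem selmer_mono {S S' : Set (HeightOneSpectrum (𝓞 K))} (h : S ⊆ S')
    (L : HeightOneSpectrum (𝓞 K) → PCond) : selmer W p κ S L ≤ selmer W p κ S' L := by
  intro c hc
  rw [mem_selmer_iff] at hc ⊢
  refine ⟨?_, hc.2⟩
  rw [mem_awayConditions_iff] at hc ⊢
  exact ⟨fun v hv hvS σ ↦ hc.1.1 v hv (fun h' ↦ hvS (h h')) σ, hc.1.2⟩

/-- Relaxing a condition above `p` enlarges the group: if `𝓛 v = 𝓛' v` or `𝓛' v = rel` at every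
`v ∣ p`, then `Sel^{𝓛,Σ} ≤ Sel^{𝓛',Σ}` (e.g. `Sel_± ≤ Sel^{±,rel}`, `Sel^{str,rel} ≤ Sel^{±,rel}` is NOT
of this form — `str ≤` anything is `condAbove_str_le` below).
[cite: CastellaWan2023, Def. 5.1 and (6.12)–(6.13) (MS pp. 23, 30)] -/
theorem selmer_le_of_rel {S : Set (HeightOneSpectrum (𝓞 K))} {L L' : HeightOneSpectrum (𝓞 K) → PCond}
    (h : ∀ v : HeightOneSpectrum (𝓞 K), ((p : ℕ) : 𝓞 K) ∈ v.asIdeal → L' v = L v ∨ L' v = .rel) :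
    selmer W p κ S L ≤ selmer W p κ S L' := by
  intro c hc
  rw [mem_selmer_iff] at hc ⊢
  refine ⟨hc.1, fun v hv ↦ ?_⟩
  rcases h v hv with h' | h'
  · rw [h']; exact hc.2 v hv
  · rw [h']; exact AddSubgroup.mem_top _

/-- **`Sel^{𝓛,Σ}(K_∞, E[p^∞])` is stable under the conjugation action of `Γ_K`** — the action through
which `Γ^ac = Gal(K_∞/K)` acts and the Pontryagin dual becomes a `Λ^ac`-module (Castella–Wan §4.2,
`X_± = Hom_{ℤ_p}(Sel_±(K, 𝐀^ac), ℚ_p/ℤ_p)`). [cite: CastellaWan2023, §4.2 (MS p. 22)] -/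
theorem conjH1_mem_selmer {S : Set (HeightOneSpectrum (𝓞 K))} {L : HeightOneSpectrum (𝓞 K) → PCond}
    (γ : absoluteGaloisGroup K) {c : W.subgroupH1 p κ.kerSubgroup} (hc : c ∈ selmer W p κ S L) :
    conjH1 κ.kerSubgroup (W.geomPrimaryTorsion p) γ c ∈ selmer W p κ S L := by
  have e : ∀ σ : absoluteGaloisGroup K,
      conjH1 κ.kerSubgroup (W.geomPrimaryTorsion p) σ
          (conjH1 κ.kerSubgroup (W.geomPrimaryTorsion p) γ c) =
        conjH1 κ.kerSubgroup (W.geomPrimaryTorsion p) (σ * γ) c :=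
    fun σ ↦ by rw [conjH1_mul_holds κ.kerSubgroup (W.geomPrimaryTorsion p) σ γ]; rfl
  rw [mem_selmer_iff] at hc ⊢
  refine ⟨?_, fun v hv ↦ conjH1_mem_condAbove W p κ v (L v) γ (hc.2 v hv)⟩
  rw [mem_awayConditions_iff] at hc ⊢
  refine ⟨fun v hv hvS σ ↦ ?_, fun w σ ↦ ?_⟩
  · rw [e]; exact hc.1.1 v hv hvS (σ * γ)
  · rw [e]; exact hc.1.2 w (σ * γ)

/-- **Bridge to the tree's signed Selmer group `lim→_n Sel^ε(E/K_n)`**: every class of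
`Kobayashi2003.signedSelmerInfty W κ ε` (Kobayashi Def. 1.1 / Iovita–Pollack Def. 6.7 / B.-D. Kim
2013 Def. 3.1 presented as a direct limit) satisfies the `K_∞`-level signed condition `ℋ^ε` at every
place above every `v ∣ p` — the containment "`Sel^±_{p^∞}(E/K_∞) = lim→ Sel^±(E/K_n)` is cut out at
`w ∣ p` by `ℋ^±_w = ⋃_n Ê^±(K_{n,w}) ⊗ ℚ_p/ℤ_p`" of Hatley–Lei–Vigni Def. 3.4 / (3.1) (restriction
commutes with conjugation, `resOfLe_comp_conjH1_holds`; restriction preserves Kummer conditions,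
`map_resOfLe_localKummerOverOfEmb_le`; `E^ε(K_n·E) ≤ E^ε(K_∞·E)`).
[cite: HatleyLeiVigni2022, Def. 3.4 and (3.1)] [cite: BDKim2013, Def. 3.1, Def. 3.3 (p. 193)] -/
theorem signedSelmerInfty_le_condAbove_sgn {v : HeightOneSpectrum (𝓞 K)}
    (hv : ((p : ℕ) : 𝓞 K) ∈ v.asIdeal) (ε : ℤˣ) :
    signedSelmerInfty W κ ε ≤ condAbove W p κ v (.sgn ε) := by
  intro s hs
  refine AddSubgroup.iSup_induction (fun n ↦ (signedSelmerLayer W κ ε n).map (W.layerToInfty κ n))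
    (C := fun s ↦ s ∈ condAbove W p κ v (.sgn ε)) hs ?_ (zero_mem _) (fun _ _ ↦ add_mem)
  rintro n _ ⟨c, hc, rfl⟩
  rw [mem_condAbove_sgn_iff]
  intro σ
  have hcσ := ((mem_signedSelmerLayer_iff W κ ε n c).1 hc).2 v hv σ
  have e : conjH1 κ.kerSubgroup (W.geomPrimaryTorsion p) σ (W.layerToInfty κ n c) =
      W.layerToInfty κ n (W.conjH1 p (κ.layerSubgroup n) σ c) := by
    change _ = ((W.resOfLe p (κ.kerSubgroup_le_layerSubgroup n)).comp
      (W.conjH1 p (κ.layerSubgroup n) σ)) c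
    rw [resOfLe_comp_conjH1_holds]
    rfl
  rw [e]
  exact localKummerOverOfEmb_signedLocalPointsOfEmb_le W p κ _ ε n
    (map_resOfLe_localKummerOverOfEmb_le W p _ (κ.kerSubgroup_le_layerSubgroup n) _ ⟨_, hcσ, rfl⟩)

/-- **Bridge to the tree's anticyclotomic Selmer group**: for `𝔮 ∣ p`, the assignment "strict at `𝔮`,
relaxed at every other prime above `p`" (`PCond.at 𝔮 .str .rel`; for `p = 𝔭𝔭̄` split and `𝔮 = 𝔭̄`
this is Castella–Wan's `(rel, str)`) gives EXACTLY `Castella2018.AcSelmer.selmerAc W p κ 𝔮 Σ`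
(strict above `𝔮`, relaxed above the other primes over `p`, trivial away from `p` outside `Σ`) — the
group whose `Λ`-dual `AcSelmer.XAc` carries the BDP-type main conjectures of the tree (Castella–Wan
Conj. 5.2 / Thm. 5.3, `CastellaWan2024.thm53_…`).
[cite: CastellaWan2023, Def. 5.1 ("`Sel^{rel,str}(K, 𝐀^ac)` consists of classes which are trivial at `𝔭̄` and satisfy no condition at `𝔭`", MS p. 23)]
[cite: Castella2018, Def. 2.2 (arXiv:1704.06608 p. 5)] -/
theorem selmer_at_str_rel_eq_selmerAc (S : Set (HeightOneSpectrum (𝓞 K))) {𝔮 : HeightOneSpectrum (𝓞 K)}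
    (h𝔮 : ((p : ℕ) : 𝓞 K) ∈ 𝔮.asIdeal) :
    selmer W p κ S (PCond.at 𝔮 .str .rel) = Castella2018.AcSelmer.selmerAc W p κ 𝔮 S := by
  ext c
  rw [mem_selmer_iff, mem_awayConditions_iff, Castella2018.AcSelmer.selmerAc,
    Castella2018.AcSelmer.mem_selmerOver_iff]
  refine ⟨fun hc ↦ ⟨hc.1.1, hc.1.2, ?_⟩, fun hc ↦ ⟨⟨hc.1, hc.2.1⟩, fun v hv ↦ ?_⟩⟩
  · have h := hc.2 𝔮 h𝔮
    rw [PCond.at_self, mem_condAbove_str_iff] at h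
    exact h
  · by_cases hv𝔮 : v = 𝔮
    · subst hv𝔮
      rw [PCond.at_self, mem_condAbove_str_iff]
      exact hc.2.2
    · rw [PCond.at_of_ne _ _ hv𝔮]
      exact AddSubgroup.mem_top _

end Global

/-! ## Part 3. The Pontryagin duals `X^{𝓛,Σ} = Hom(Sel^{𝓛,Σ}(K_∞, E[p^∞]), ℚ_p/ℤ_p)` as
`Λ^ac = ℤ_p⟦T⟧`-modules (constructed; the module structure is a `def`, no instance) -/

section Dual

variable {K : Type u} [Field K] [NumberField K]
variable (W : WeierstrassCurve K) (p : ℕ) [Fact p.Prime] (κ : ZpExtension K p)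
  (S : Set (HeightOneSpectrum (𝓞 K))) (L : HeightOneSpectrum (𝓞 K) → PCond)

/-- `conj_γ` restricted to an endomorphism of `Sel^{𝓛,Σ}(K_∞, E[p^∞])` (`conjH1_mem_selmer`).
[cite: CastellaWan2023, §4.2 (MS p. 22), the `Λ^ac`-action] -/
def conjSelmer (γ : absoluteGaloisGroup K) : AddMonoid.End (selmer W p κ S L) :=
  ((conjH1 κ.kerSubgroup (W.geomPrimaryTorsion p) γ).restrict (selmer W p κ S L)).codRestrict
    (selmer W p κ S L) fun s ↦ conjH1_mem_selmer γ s.2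

/-- Unfolding `conjSelmer`: on classes it is `conj_γ` (definitional).
[cite: CastellaWan2023, §4.2 (MS p. 22), the `Λ^ac`-action] -/
@[simp]
theorem coe_conjSelmer_apply (γ : absoluteGaloisGroup K) (s : selmer W p κ S L) :
    ((conjSelmer W p κ S L γ s : selmer W p κ S L) : W.subgroupH1 p κ.kerSubgroup) =
      conjH1 κ.kerSubgroup (W.geomPrimaryTorsion p) γ s :=
  rfl

/-- Powers of the restriction are restrictions of `conj_{γ^m}` (conjugation is an action,
`conjH1_one_holds`, `conjH1_mul_holds`). [cite: CastellaWan2023, §4.2 (MS p. 22), the `Λ^ac`-action] -/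
theorem coe_conjSelmer_pow_apply (γ : absoluteGaloisGroup K) (m : ℕ) (s : selmer W p κ S L) :
    ((((conjSelmer W p κ S L γ) ^ m) s : selmer W p κ S L) : W.subgroupH1 p κ.kerSubgroup) =
      conjH1 κ.kerSubgroup (W.geomPrimaryTorsion p) (γ ^ m) s := by
  induction m generalizing s with
  | zero =>
    rw [pow_zero, pow_zero, AddMonoid.End.one_apply,
      conjH1_one_holds κ.kerSubgroup (W.geomPrimaryTorsion p), AddMonoidHom.id_apply]
  | succ m ih =>
    rw [pow_succ, AddMonoid.End.coe_mul, Function.comp_apply, ih, coe_conjSelmer_apply, pow_succ,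
      conjH1_mul_holds κ.kerSubgroup (W.geomPrimaryTorsion p), AddMonoidHom.comp_apply]

/-- **`Sel^{𝓛,Σ}(K_∞, E[p^∞])` is `p`-primary and `T = γ − 1` is locally nilpotent on it** for `γ` a
topological generator of `Gal(K_∞/K)`: every class is killed by some `p^k` (compactness of
`Gal(K̄/K_∞)`, `WeierstrassCurve.exists_pow_smul_subgroupH1_ker_eq_zero`) and fixed by some
`conj_{γ^{p^a}}` (continuity, `WeierstrassCurve.exists_conjH1_pow_prime_pow_eq`), hence killed by
`(conj_γ − 1)^{k p^a}` (`IwasawaDual.pow_mul_prime_pow_apply_eq_zero`) — verbatim the argument of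
`Castella2018.AcSelmer.isLocNil_conjSelmerAc_sub_one`. This is what makes the dual a `Λ^ac`-module
("`Λ^ac = ℤ_p⟦Γ^ac⟧` … `Y = γ^ac − 1`", Castella–Wan §2, §4.1).
[cite: CastellaWan2023, §2 (MS p. 5) and §4.1 (MS p. 19, "`Y = γ^ac − 1`")] [cite: GreenbergLNM1716, §1 (after Conj. 1.3)] -/
theorem isLocNil_conjSelmer_sub_one {γ : absoluteGaloisGroup K} (hγ : κ.IsTopGenerator γ) :
    IwasawaDual.IsLocNil p (conjSelmer W p κ S L γ - 1) := by
  have htor : ∀ s : selmer W p κ S L, ∃ k : ℕ, p ^ k • s = 0 := fun s ↦ by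
    obtain ⟨k, hk⟩ := W.exists_pow_smul_subgroupH1_ker_eq_zero κ (s : W.subgroupH1 p κ.kerSubgroup)
    exact ⟨k, Subtype.ext (by rw [AddSubgroupClass.coe_nsmul]; exact hk)⟩
  refine ⟨htor, fun s ↦ ?_⟩
  obtain ⟨a, ha⟩ := W.exists_conjH1_pow_prime_pow_eq κ hγ (s : W.subgroupH1 p κ.kerSubgroup)
  obtain ⟨k, hk⟩ := htor s
  have hφ : ((conjSelmer W p κ S L γ) ^ p ^ a) s = s :=
    Subtype.ext (by rw [coe_conjSelmer_pow_apply]; exact ha)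
  exact ⟨k * p ^ a, IwasawaDual.pow_mul_prime_pow_apply_eq_zero (Fact.out : p.Prime) _ a hφ hk⟩

/-- **`X^{𝓛,Σ} := Hom(Sel^{𝓛,Σ}(K_∞, E[p^∞]), ℚ/ℤ)`**, the Pontryagin dual (`ℚ/ℤ = AddCircle (1 : ℚ)
⊇ ℚ_p/ℤ_p` receives every character of the torsion group, as in `WeierstrassCurve.SelmerDualData`
and `Castella2018.AcSelmer.XAc`). Castella–Wan §4.2: "`X_± = Hom_{ℤ_p}(Sel_±(K, 𝐀^ac), ℚ_p/ℤ_p)`";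
Def. 5.1: "`X^𝓛` denote[s] the Pontryagin dual of `Sel^𝓛(K, 𝐀^ac)` … `X^{𝓛,Σ}`"; Hatley–Lei–Vigni
§1.1 (`M^∨ := Hom^cont_{ℤ_p}(M, ℚ_p/ℤ_p)`), Longo–Vigni ("Pontryagin duals `𝒳^±_∞`"). An `abbrev`
(a bare abelian group); its `Λ^ac`-module structure is the DEFINITION `X.moduleOfGen` below (no
instance is declared in this file). [cite: CastellaWan2023, §4.2 and Def. 5.1 (MS pp. 22–23)] -/
abbrev X : Type u :=
  selmer W p κ S L →+ AddCircle (1 : ℚ)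

/-- **The `Λ^ac = ℤ_p⟦T⟧`-module structure of `X^{𝓛,Σ}`** attached to a topological generator `γ` of
`Gal(K_∞/K)`: `T` acts as `conj_γ − 1` and the constants through `ℤ_p → ℤ/p^k`
(`IwasawaDual.IsLocNil.module` for `isLocNil_conjSelmer_sub_one`) — Castella–Wan's identification
"`Λ^ac` with the one variable power series ring `ℤ_p⟦Y⟧` setting `Y = γ^ac − 1`" (§4.1, MS p. 19;
Hatley–Lei–Vigni §2.2 "`γ_∞ ↦ 1 + X`"). A `def` to be activated with `letI` (as `IwasawaDual.IsLocNil.module`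
itself), NOT an instance; CONSTRUCTED, not assumed.
[cite: CastellaWan2023, §4.1 (MS p. 19, "`Y = γ^ac − 1`")] [cite: HatleyLeiVigni2022, §2.2] -/
@[reducible]
def X.moduleOfGen {γ : absoluteGaloisGroup K} (hγ : κ.IsTopGenerator γ) :
    Module (IwasawaAlgebra p) (X W p κ S L) :=
  (isLocNil_conjSelmer_sub_one W p κ S L hγ).module

/-- **`T` acts as `γ − 1`** on `X^{𝓛,Σ}`: `(T·x)(s) = x(conj_γ s) − x(s)`.
[cite: CastellaWan2023, §4.1 (MS p. 19, "`Y = γ^ac − 1`")] -/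
theorem X.X_smul_apply {γ : absoluteGaloisGroup K} (hγ : κ.IsTopGenerator γ) (x : X W p κ S L)
    (s : selmer W p κ S L) :
    (letI := X.moduleOfGen W p κ S L hγ; ((PowerSeries.X : IwasawaAlgebra p) • x) s) =
      x (conjSelmer W p κ S L γ s) - x s := by
  show (isLocNil_conjSelmer_sub_one W p κ S L hγ).smulFun PowerSeries.X x s = _
  rw [(isLocNil_conjSelmer_sub_one W p κ S L hγ).smulFun_X_apply, IwasawaDual.End_sub_apply,
    AddMonoid.End.one_apply, map_sub]

/-- **Constants `c ∈ ℤ_p` act through `ℤ_p → ℤ/p^k`** on the value at a `p^k`-torsion class: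
`(c·x)(s) = (c mod p^k) · x(s)`. [cite: Lang1990, Ch. 5 §1] -/
theorem X.C_smul_apply {γ : absoluteGaloisGroup K} (hγ : κ.IsTopGenerator γ) (c : ℤ_[p])
    (x : X W p κ S L) {s : selmer W p κ S L} {k : ℕ} (hk : p ^ k • s = 0) :
    (letI := X.moduleOfGen W p κ S L hγ; ((PowerSeries.C c : IwasawaAlgebra p) • x) s) =
      (PadicInt.toZModPow k c).val • x s := by
  show (isLocNil_conjSelmer_sub_one W p κ S L hγ).smulFun (PowerSeries.C c) x s = _
  exact (isLocNil_conjSelmer_sub_one W p κ S L hγ).smulFun_C_apply c x hk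

/-- **`char_{Λac}(X^{𝓛,Σ}) ⊆ Λ`**, the characteristic ideal (the tree's `Module.charIdeal`; meaningful
for finitely generated torsion modules, which is NOT asserted) of `X^{𝓛,Σ}` under the module
structure of the generator `γ`. Castella–Wan Conj. 5.2 ("`char_{Λac}(X^{rel,str})`"), (6.15)
("`char_{Λac}(X^{±,str})`"). [cite: CastellaWan2023, Conj. 5.2 and (6.15) (MS pp. 23, 31)] -/
def X.charIdeal {γ : absoluteGaloisGroup K} (hγ : κ.IsTopGenerator γ) : Ideal (IwasawaAlgebra p) :=
  letI := X.moduleOfGen W p κ S L hγ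
  Module.charIdeal (IwasawaAlgebra p) (X W p κ S L)

/-- **`char_{Λac}(X^{𝓛,Σ}_tors)`**, the characteristic ideal of the `Λ`-TORSION submodule
(`Submodule.torsion`) — the left-hand side of Castella–Wan's Conj. 4.8 (3) / Thm. 6.9 / Lemma 6.7 (2)
("`char_{Λac}(X^±_tors)`, where the subscript tors denotes the `Λ^ac`-torsion submodule"), in the
currency of the tree's `Howard2004_thmB` (`Module.charIdeal Λ (Submodule.torsion Λ X)`).
[cite: CastellaWan2023, Conj. 4.8 (3) and Lemma 6.7 (2) (MS pp. 22, 28)] -/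
def X.torsionCharIdeal {γ : absoluteGaloisGroup K} (hγ : κ.IsTopGenerator γ) :
    Ideal (IwasawaAlgebra p) :=
  letI := X.moduleOfGen W p κ S L hγ
  Module.charIdeal (IwasawaAlgebra p) (Submodule.torsion (IwasawaAlgebra p) (X W p κ S L))

/-- **"`X^{𝓛,Σ}` is a finitely generated `Λ^ac`-module of rank `r`"** (`Module.Finite` and
`Module.finrank = r`; the rank of a finitely generated module over the domain `Λ`, as in
`Howard2004_thmB`) — the shape of Castella–Wan Conj. 4.8 (2) / Thm. 6.9 / Thm. A.5 ("`X_±` ha[s]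
`Λ^ac`-rank one"), Lemma 6.7, and of Longo–Vigni Thm. 1.4 ("each of the two `Λ`-modules `𝒳^±_∞` has
rank `1`"). A predicate; nothing asserted. [cite: CastellaWan2023, Conj. 4.8 (2) (MS p. 22)]
[cite: LongoVigni2019, Thm. 1.4] -/
def X.HasRank {γ : absoluteGaloisGroup K} (hγ : κ.IsTopGenerator γ) (r : ℕ) : Prop :=
  letI := X.moduleOfGen W p κ S L hγ
  Module.Finite (IwasawaAlgebra p) (X W p κ S L) ∧ Module.finrank (IwasawaAlgebra p) (X W p κ S L) = r

/-- **"`X^{𝓛,Σ}` is a finitely generated TORSION `Λ^ac`-module"** (`Module.Finite ∧ Module.IsTorsion`)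
— the shape of "`X^{rel,str}` is `Λ^ac`-torsion" (Castella–Wan Conj. 5.2, Thm. 6.8 (ii)) and of
"`Sel^±_p(E/F_∞)` is `Λ`-cotorsion" (B.-D. Kim 2013 Thm. 1.1). A predicate; nothing asserted.
[cite: CastellaWan2023, Conj. 5.2 (MS p. 23)] [cite: BDKim2013, Thm. 1.1 (p. 190)] -/
def X.IsFGTorsion {γ : absoluteGaloisGroup K} (hγ : κ.IsTopGenerator γ) : Prop :=
  letI := X.moduleOfGen W p κ S L hγ
  Module.Finite (IwasawaAlgebra p) (X W p κ S L) ∧ Module.IsTorsion (IwasawaAlgebra p) (X W p κ S L)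

/-- **"`X^{𝓛,Σ}` has no non-zero finite `Λ`-submodule"** ⟺ "`Sel^{𝓛,Σ}` has no proper `Λ`-submodule
of finite index" (Hatley–Lei–Vigni §1: "these Selmer groups have no proper `Λ`-submodules of finite
index or, equivalently, … their Pontryagin duals have no nontrivial finite `Λ`-submodules"), in the
currency of the tree's `KitajimaOtsuki2018` facts (`∀ N, Finite N → N = ⊥`). A predicate; nothing
asserted. [cite: HatleyLeiVigni2022, §1 and Thm. 1.1] [cite: BDKim2013, Thm. 1.1 / Thm. 3.14 (pp. 190, 199)] -/
def X.NoFiniteSubmodule {γ : absoluteGaloisGroup K} (hγ : κ.IsTopGenerator γ) : Prop :=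
  letI := X.moduleOfGen W p κ S L hγ
  ∀ N : Submodule (IwasawaAlgebra p) (X W p κ S L), Finite N → N = ⊥

end Dual

/-! ## Part 4. The anticyclotomic supersingular setting and the published structure theorems
(named facts, statements only; hypotheses as printed, specialised as documented) -/

section Facts

variable (W : WeierstrassCurve ℚ) [W.IsGloballyMinimal] (K : Type) [Field K] [NumberField K]
  (p : ℕ) [Fact p.Prime] (κ : ZpExtension K p) (𝔭 𝔭' : HeightOneSpectrum (𝓞 K))

/-- **The common setting of Iovita–Pollack 2006, B.-D. Kim 2013, Hatley–Lei–Vigni 2022,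
Longo–Vigni 2019 and Castella–Wan §4, SPECIALISED to the anticyclotomic tower of an imaginary
quadratic field at a split prime** (the case of the BSD summit's route `UniversalToricDescent`,
crux `TwinSplitIMCAtThreeGoodSSApZero`): `E/ℚ` elliptic (globally minimal model `W`, to read `a_p`);
`p` ODD ("`p` an odd supersingular prime", Iovita–Pollack §2; "`p` will denote an odd prime number",
Hatley–Lei–Vigni §1.1; Castella–Wan §3 "an odd prime `p` with `a_p = 0`") of good SUPERSINGULAR
reduction with `a_p = 0` ("Throughout this paper, we assume that `a_p = 0`", B.-D. Kim 2013 p. 190;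
`Rank1Residual.GoodSS` = good reduction and `p ∣ a_p`); `K` imaginary quadratic with `p = 𝔭𝔭'`
SPLIT (two distinct primes above `p`; Iovita–Pollack's Hypothesis (S) "`p` splits completely in `K`",
Castella–Wan (spl), Hatley–Lei–Vigni (Heeg) at `p`; it makes `K_𝔭 = ℚ_p`, so B.-D. Kim's "`p`
unramified in `F`", "`F_{∞,q}` abelian over `ℚ_p`" and "`p` splits completely" of §3 hold); `κ` THE
anticyclotomic `ℤ_p`-extension; and `p ∤ h_K`, the printed SUFFICIENT condition for "the two primes of
`K` above `p` are totally ramified in `K_∞`" (Hatley–Lei–Vigni §1.1: "this … holds if `p` does not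
divide the class number of `K`"; Longo–Vigni Assumption 1.3; Iovita–Pollack (S); Castella–Wan §4.1:
"`δ = 0` when the class number of `K` is coprime to `p`") — a SPECIAL CASE of the printed hypothesis
(TODO(general form): `ZpExtension.TotallyRamifiedFrom κ 0`). A `Prop`-valued structure; nothing is
asserted. [cite: IovitaPollack2006, §2 Hypothesis (S) (arXiv:math/0411496 p. 5)]
[cite: HatleyLeiVigni2022, §1.1–1.2] [cite: BDKim2013, §3 standing hypotheses (p. 192)] -/
structure Setting : Prop where
  /-- `E` is an elliptic curve. -/
  isElliptic : W.IsElliptic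
  /-- `p` is odd. -/
  p_ne_two : p ≠ 2
  /-- good supersingular reduction at `p` (good and `p ∣ a_p`). -/
  goodSS : Rank1Residual.GoodSS W p
  /-- `a_p = 0`. -/
  frobeniusTrace_eq_zero : W.frobeniusTrace p = 0
  /-- `K` is imaginary quadratic. -/
  isImaginaryQuadratic : IsImaginaryQuadratic K
  /-- `𝔭` lies above `p`. -/
  mem : ((p : ℕ) : 𝓞 K) ∈ 𝔭.asIdeal
  /-- `𝔭'` lies above `p`. -/
  mem' : ((p : ℕ) : 𝓞 K) ∈ 𝔭'.asIdeal
  /-- `𝔭' ≠ 𝔭`: `p` splits in `K`. -/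
  ne : 𝔭' ≠ 𝔭
  /-- `κ` is the anticyclotomic `ℤ_p`-extension of `K`. -/
  anticyclotomic : κ.IsAnticyclotomic
  /-- `p ∤ h_K` (hence the primes above `p` are totally ramified in `K_∞/K`). -/
  not_dvd_classNumber : ¬ p ∣ NumberField.classNumber K

/-- **B.-D. Kim 2013, Prop. 3.2 (after Kim 2007 Prop. 3.1, "a slight generalization of [Kobayashi
2003, Prop. 8.7]"; Iovita–Pollack Lemma 2.1 / Lemma 4.6): the local points along the tower have no
`p`-torsion.** Printed: "For any `n` and a prime `v` of `F_n` above `p`, `E(F_{n,v})` is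
`p`-torsion-free. … In particular, `E(F_{∞,v})` is `p`-torsion-free, which implies that
`A^{G_{F_{∞,v}}} = 0`" (the input of every inflation–restriction step: `H¹(F_{n,v}, A) ≅
H¹(F_{∞,v}, A)^{Gal}`, `H¹(F_{n,v}, A[p^k]) = H¹(F_{n,v}, A)[p^k]`; Hatley–Lei–Vigni Lemma 3.8).
Transcribed in the `Setting` (a special case of Kim's §3 hypotheses) for the base change `W⁄K`, at
each of the two primes above `p` (chosen embedding `closureEmb` of the completion), on the tree's
layer groups `Kobayashi2003.localLayerPointsOfEmb` and their union `localPointsInfty`.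
[cite: BDKim2013, Prop. 3.2 (p. 193)] [cite: IovitaPollack2006, Lemma 2.1 (arXiv:math/0411496 p. 5)] -/
def bdKim2013_prop32_localPoints_noPTorsion : Prop :=
  ∀ (_ : Setting W K p κ 𝔭 𝔭') (v : HeightOneSpectrum (𝓞 K)), ((p : ℕ) : 𝓞 K) ∈ v.asIdeal →
    ∀ P : localPoints (W.baseChange K) (v.adicCompletion K),
      P ∈ localPointsInfty κ (closureEmb (K := K) (v.adicCompletion K)) (W.baseChange K) →
        p • P = 0 → P = 0

/-- **Iovita–Pollack 2006, Lemma 2.1 (global half): `E(K_∞)[p] = 0`.** Printed: "Hypothesis (S)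
implies that `E(K_{𝔭_i})[p] = 0` and `E(K_∞)[p] = 0`" (proof: `Ẽ(𝔽_p)` and `Ê(ℚ_p)` have no
`p`-torsion at a supersingular `p`, `K_{𝔭_i} ≅ ℚ_p`, and `Γ = Gal(K_∞/K)` is pro-`p`). Castella–Wan
use it as "`E(K_∞)[p^∞] = 0`, which by [PR00, §1.3.3] implies that the `Λ^ac`-torsion submodule of
`H¹(K, 𝐓^ac)` is trivial" (proof of Thm. 6.8) and in Lemma A.1. Transcribed in the `Setting` on the
geometric points `E(K̄)` of `W⁄K` fixed by `Gal(K̄/K_∞) = ker κ`.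
[cite: IovitaPollack2006, Lemma 2.1 (arXiv:math/0411496 p. 5)]
[cite: CastellaWan2023, proof of Thm. 6.8 (MS p. 30) and Lemma A.1 (MS p. 34)] -/
def iovitaPollack2006_lemma21_noPTorsion_top : Prop :=
  ∀ (_ : Setting W K p κ 𝔭 𝔭') (P : (W.baseChange K).geomPoints),
    (∀ τ : absoluteGaloisGroup K, τ ∈ κ.kerSubgroup → τ • P = P) → p • P = 0 → P = 0

/-- **Hatley–Lei–Vigni 2022, Prop. 3.9 with Lemma 3.7 (the signed control theorem, between the base
`K` and the top `K_∞`).** Printed, Prop. 3.9: "Let `E/ℚ` be an elliptic curve satisfying (Tam). Let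
`m, m', n, n' ∈ ℕ ∪ {∞}` with `m ≤ m'` and `n ≤ n'`. The restriction map induces an isomorphism of
`Λ`-modules `Sel^±_{p^m}(E/K_n) ≃ Sel^±_{p^{m'}}(E/K_{n'})[p^m]^{𝒢_{n'/n}}`", where (Tam): "the prime
`p` does not divide `#(E/E⁰)`" (no Tamagawa number of `E` is divisible by `p`); Lemma 3.7: "For all
`m ∈ ℕ ∪ {∞}`, `Sel^±_{p^m}(E/K) = Sel_{p^m}(E/K)`"; Remark 3.5: the finite-layer groups of [HLV]
differ from those of [IP]/[Kobayashi] "unless the base field is `K_0 = K` or `K_∞`". Standing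
(§1.1–1.2): `p` odd, `E/ℚ` of conductor `N` with good supersingular reduction at `p` and
`a_p(E) = 0`, (Heeg) "every prime number dividing `Np` splits in `K`", the two primes above `p`
totally ramified in `K_∞` (here via `p ∤ h_K`, `Setting`). TRANSCRIBED at `m = m' = ∞`, `n = 0`,
`n' = ∞` — the case Castella–Wan's descent uses ((6.16): `X_+/P_0X_+ → Sel_{p^∞}(E/K)`) —, on the
tree's objects: the restriction `layerToInfty κ 0 : H¹(K, E[p^∞]) → H¹(K_∞, E[p^∞])` is injective on
`Sel_{p^∞}(E/K) = selmerLayer κ 0` and its image there is exactly the `Γ`-invariants (`conj_σ s = s`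
for all `σ ∈ Γ_K`; inner automorphisms act trivially) of `Sel^ε(E/K_∞) = Kobayashi2003.signedSelmerInfty`
(= [HLV]'s `Sel^±_{p^∞}(E/K_∞)` by Remark 3.5, modulo the away-from-`p` flag `away-p` of the module
docstring). [cite: HatleyLeiVigni2022, Prop. 3.9, Lemma 3.7, Remark 3.5 and hypotheses (Heeg), (Tam) of §1.2] -/
def hatleyLeiVigni2022_prop39_control_base : Prop :=
  ∀ (_ : Setting W K p κ 𝔭 𝔭') (N : ℕ), (W.conductorNorm ℤ : ℕ) = N → SatisfiesHeegnerHypothesis N K →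
    ¬ p ∣ W.tamagawaProduct → ∀ ε : ℤˣ,
    (∀ c ∈ (W.baseChange K).selmerLayer κ 0, (W.baseChange K).layerToInfty κ 0 c = 0 → c = 0) ∧
    ∀ s : (W.baseChange K).subgroupH1 p κ.kerSubgroup,
      s ∈ ((W.baseChange K).selmerLayer κ 0).map ((W.baseChange K).layerToInfty κ 0) ↔
        s ∈ signedSelmerInfty (W.baseChange K) κ ε ∧
          ∀ σ : absoluteGaloisGroup K, (W.baseChange K).conjH1 p κ.kerSubgroup σ s = s

/-- **Longo–Vigni 2019, Thm. 1.4 (= Thm. 4.1): each of the Pontryagin duals `𝒳^±_∞` of the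
restricted (plus/minus) Selmer groups `Sel^±_{p^∞}(E/K_∞)` à la Kobayashi / Iovita–Pollack has
`Λ`-rank `1`.** Printed hypotheses: `E/ℚ` of conductor `N > 3` WITHOUT complex multiplication;
Assumption 1.1 "(1) `p ≥ 5` is a prime of good supersingular reduction for `E`; (2) `ρ_{E,p}` is
surjective" (`ρ_{E,p} : G_ℚ → Aut(T_p(E)) ≃ GL₂(ℤ_p)`); Assumption 1.2 for `N = MD` "the primes
dividing `pM` split in `K`; the primes dividing `D` are inert in `K`" (`D ≥ 1` square-free with an even
number of prime factors); Assumption 1.3 "The two primes of `K` above `p` are totally ramified in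
`K_∞`" ("which holds when `p` does not divide the class number of `K`"). TRANSCRIBED in the case
`D = 1` (every prime of `N` splits: `SatisfiesHeegnerHypothesis`) — TODO(general form): `N = MD` —,
with `5 ≤ p` VERBATIM (so `a_p = 0` is automatic and the `Setting`'s `a_p = 0` is no restriction),
`ρ_{E,p}` onto as "every `ℤ_p`-automorphism of `T_p E` is a Galois element" (the currency of
`HowardHypotheses.surjective`, over `ℚ`), on every Pontryagin-dual datum
`Kobayashi2003.SignedSelmerDualData (W⁄K) κ γ ε` of `Sel^ε(E/K_∞) = Kobayashi2003.signedSelmerInfty`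
(finitely generated of `finrank` one over `Λ = ℤ_p⟦T⟧`, `T = γ − 1`). This is the `X_±`-half of
Castella–Wan's Conj. 4.8 (2) in refereed print for `p ≥ 5` (flags `CW24-local-condition`, `away-p`).
[cite: LongoVigni2019, Thm. 1.4 and Assumptions 1.1–1.3 (arXiv:1503.07812 p. 3)] -/
def longoVigni2019_thm14_signedSelmerDual_rank_one : Prop :=
  ∀ (_ : Setting W K p κ 𝔭 𝔭') (N : ℕ), (W.conductorNorm ℤ : ℕ) = N → 3 < N →
    SatisfiesHeegnerHypothesis N K → 5 ≤ p → ¬ W.HasCM →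
    (∀ f : Module.End ℤ_[p] (W.tateModule p), IsUnit f → f ∈ Set.range (W.galoisRepTate p)) →
    ∀ (γ : absoluteGaloisGroup K), κ.IsTopGenerator γ → ∀ (ε : ℤˣ)
      (D : SignedSelmerDualData (W.baseChange K) κ γ ε),
      Module.Finite (IwasawaAlgebra p) D.X ∧ Module.finrank (IwasawaAlgebra p) D.X = 1

end Facts

end Literature.NumberTheory.EllipticCurves.AcSigned

end
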